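import Literature.NumberTheory.LFunctions.KowalskiMichelPeterssonFormulaOfHeckeL2
import Literature.NumberTheory.LFunctions.KowalskiMichelPeterssonFormulaOfHeckeL2Prime
import Literature.NumberTheory.ModularForms.PoincareSeriesWeightTwoL2OfGram
import Literature.NumberTheory.ModularForms.PoincareSeriesWeightTwoGramLimit
import HarnessLib

/-!
# Kowalski–Michel 2000 — Petersson's formula (§2.4.2 p. 312) and the printed Petersson bound (23) HOLD

`kowalskiMichel2000_peterssonFormula_holds`: the printed Petersson formula at prime level `q`, weight 2,
`Δ_q(l₁,l₂) = δ(l₁,l₂) − J_q(l₁,l₂)`, `J_q(l₁,l₂) = (2π/q) Σ_r r⁻¹ S(l₁,l₂;qr) J₁(4π√(l₁l₂)/(qr))` with its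
absolutely convergent Kloosterman–Bessel series, is a THEOREM of the tree.  Proof = the weight-2 Poincaré
series by Hecke's trick (Iwaniec–Kowalski §14.1–14.2 with §3.2), all of whose pieces are kernel-checked
Literature theorems (fact skeleton I1, line `poincare_hecke`, cell `landau-siegel/ls-inputs`):
convergence and automorphy `heckeConvergence`, Fourier modes `heckeFourierModes`, Hecke's pointwise limit
`heckeLimit_of_fourierModes`, unfolding `heckeUnfolding`, the `L²` step — square-integrability
`peterssonSqIntegrable_rpow_im_mul_poincareHecke`, the Gram limit `tendsto_gram_peterssonPairing` (cell
integrals with the `e(−A/τ)` decay, `PoincareSeriesWeightTwoCellDecay`) and the Fatou/Gram assembly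
`heckeL2_at_of_gram_limit` —, the `L²`-holomorphic ⇒ cusp form step `cuspFormOfL2`, the assembly
`poincareAssembly` / `poincareExists_of_heckeL2`, and the prime-level newform Parseval step
`cuspCoeff_eq_mul_pet_of_peterssonProduct_eq`; composed by `peterssonFormula_of_heckeL2`.
(An independent second closure of the `L²` step at prime level — uniform majorant near both cusps of
`Γ₀(q)`, `PoincareSeriesWeightTwoHeckeMajorant.heckeDomination_prime` with
`peterssonFormula_of_heckeDomination_prime` — is also in the tree.)

`poincareExists`: for EVERY level `N ≥ 1` and `m ≥ 1` the weight-2 Poincaré cusp form with the printed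
coefficients `δ(m,n) − √(n/m)·J_N(m,n)` and the reproducing property `⟨P, f⟩ = a_f(m)/(4πm)`.
`kowalskiMichel2000_peterssonBound_holds`: the printed consequence (23) in gcd form, by
`peterssonBound_of_peterssonFormula'` (Weil's bound discharged there).
-/

noncomputable section

open scoped Real Topology
open CongruenceSubgroup Filter
open UpperHalfPlane hiding I
open Literature.NumberTheory.EllipticCurves.ModularForms
open Literature.NumberTheory.ModularForms.PoincareWeightTwo

namespace Literature.NumberTheory.LFunctions.KowalskiMichel2000

/-- **Hecke's `L²` limit for the weight-2 Poincaré series, every level `N ≥ 1` and `m ≥ 1`** (the T4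
statement of the I1 skeleton): `Q_m` and `yˢP_m(·,s)` (`s > 0`) are Petersson-square-integrable and
`Re⟪yˢP_m(·,s) − Q_m, yˢP_m(·,s) − Q_m⟫ → 0` as `s → 0⁺` — the Gram limit `tendsto_gram_peterssonPairing`
fed into the Fatou/Gram assembly `heckeL2_at_of_gram_limit`.
[cite: IwaniecKowalski2004, §14.2 with §3.2 (Hecke's trick), k = 2] -/
theorem heckeL2_allLevels (N : ℕ) [NeZero N] (m : ℕ) (hm : 1 ≤ m) :
    PeterssonSqIntegrable N 2 (poincareQSeries N m) ∧
      (∀ s : ℝ, 0 < s →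
        PeterssonSqIntegrable N 2 (fun z : ℍ ↦ ((z.im ^ s : ℝ) : ℂ) * poincareHecke N m s z)) ∧
      Tendsto (fun s : ℝ ↦ (peterssonPairing N 2
          (fun z : ℍ ↦ ((z.im ^ s : ℝ) : ℂ) * poincareHecke N m s z - poincareQSeries N m z)
          (fun z : ℍ ↦ ((z.im ^ s : ℝ) : ℂ) * poincareHecke N m s z - poincareQSeries N m z)).re)
        (𝓝[>] 0) (𝓝 0) :=
  heckeL2_at_of_gram_limit N hm _ (tendsto_gram_peterssonPairing hm)

/-- **The weight-2 Poincaré cusp forms exist at every level, with the printed coefficients and the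
reproducing property** (Iwaniec–Kowalski Lemmas 14.2–14.3 at `k = 2`, via Hecke's trick): for `N ≥ 1`
and `m ≥ 1` there is `P ∈ S_2(Γ₀(N))` with `a_P(n) = δ(m,n) − √(n/m)·J_N(m,n)` (`n ≥ 1`) and
`⟨P, f⟩ = a_f(m)/(4πm)` for all `f ∈ S_2(Γ₀(N))` (`peterssonProduct`, `cuspCoeff` normalisations of the
tree). [cite: IwaniecKowalski2004, Lemma 14.2, Lemma 14.3 and the remark after (14.13), k = 2] -/
theorem poincareExists (N : ℕ) [NeZero N] (m : ℕ) (hm : 1 ≤ m) :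
    ∃ P : CuspForm (Gamma0 N) 2,
      (∀ n : ℕ, 1 ≤ n → cuspCoeff P n = poincareCoeff N m n) ∧
      (∀ f : CuspForm (Gamma0 N) 2,
        peterssonProduct (Gamma0 N) 2 P f = ((1 / (4 * π * m) : ℝ) : ℂ) * cuspCoeff f m) :=
  poincareExists_of_heckeL2 (fun N _ m hm ↦ heckeL2_allLevels N m hm) N m hm

/-- **Kowalski–Michel 2000, §2.4.2 p. 312 — PETERSSON'S FORMULA AT PRIME LEVEL AND WEIGHT 2 HOLDS**:
for `q` prime and `l₁, l₂ ≥ 1`, `Σ_r ‖(qr)⁻¹ S(l₁,l₂;qr) J₁(4π√(l₁l₂)/(qr))‖ < ∞` and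
`Δ_q(l₁,l₂) = δ(l₁,l₂) − J_q(l₁,l₂)` — `peterssonFormula_of_heckeL2` applied to `heckeL2_allLevels`.
[cite: KowalskiMichel2000, §2.4.2 p. 312 (Petersson's formula); IwaniecKowalski2004, §14.1–14.2] -/
theorem kowalskiMichel2000_peterssonFormula_holds : kowalskiMichel2000_peterssonFormula :=
  peterssonFormula_of_heckeL2 fun N _ m hm ↦ heckeL2_allLevels N m hm

/-- **Kowalski–Michel 2000, (23) p. 312 — THE PRINTED PETERSSON-TYPE BOUND (gcd form) HOLDS**: for
every `ε > 0` there is `C` with `|Δ_q(m,n) − δ(m,n)| ≤ C (mn)^{1/2+ε} q^{−3/2}` for all primes `q` and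
all `m, n ≥ 1` with `q ∤ (m,n)` — from the formula and Weil's bound (`peterssonBound_of_peterssonFormula'`).
[cite: KowalskiMichel2000, §2.4.2 p. 312 (23)] -/
theorem kowalskiMichel2000_peterssonBound_holds : kowalskiMichel2000_peterssonBound :=
  peterssonBound_of_peterssonFormula' kowalskiMichel2000_peterssonFormula_holds

end Literature.NumberTheory.LFunctions.KowalskiMichel2000

end
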